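import Literature.AlgebraicGeometry.ShimuraVarieties.UnitaryShimuraCurveSpecialCurveInjective
import Literature.AlgebraicGeometry.ShimuraVarieties.UnitaryBallSpecialCurveLevelOfCode
import Literature.NumberTheory.Automorphic.UnitaryGroupCongruenceSubgroupLevels
import Literature.NumberTheory.Automorphic.UnitaryGroupRationalRepresentatives
import HarnessLib

/-!
# The special curves of the surface pieces, INDEXED by the curve's double cosets (road (ii), leaf L3.3 (c): indexing + assembly)

Topic `AlgebraicGeometry/ShimuraVarieties`, namespace `…ShimuraVarieties.UnitaryCanonicalModel`.  THEOREMS ONLY (no definition,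
no named fact, no instance, no `sorry`).  Cell `hodgecm-mathlib`, road (ii) «embedded-curve descent» of the census «GS-3 ⇐ #62»;
books 0 — nothing here is a proof of GS-3.

SETTING (one surface level `K ≤ U(H)(𝔸_{L⁺,f})`, one compact open curve level `K⋆ ≤ U(J⋆)(𝔸_{L⁺,f})` with `φGS(K⋆) ≤ K`, frame
scalar `a = 1`).  The complex pieces of the surface `(M_K)_τ` CODED over `L`: ball-quotient data `Bq q : UnitaryBallUniformisationDatum 2
(X q)` indexed by the surface double cosets `q ∈ U(H)(L⁺) \ U(H)(𝔸_f) / K` with a section `g_q` (`⟦g_q K⟧ = q`), codes `e_q : L ≃+* (Bq q).E`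
over `τ`, `(Bq q).H = H^{e_q}`, `(Bq q).Γ = Γ_H(g_q K g_q⁻¹)^{e_q}` (the `pieces` clause of the surface record read in subfield-code
currency); an `L`-frame `ᵗ(cB)·H·B = J⋆ ⊕ᶠ J⊥` with `Re τ(J⊥₀₀) > 0`; the embedding `embPoints : Sh_{K⋆}(U(J⋆))(ℂ) → Sh_K(U(H))(ℂ)`
INJECTIVE (★ F-INJ); and the two LEVEL-JUNCTION clauses of the trace pair in `L`-currency (`hJ1`: the curve level
`Γ_{J⋆}(g⋆ K⋆ g⋆⁻¹)` conjugated by the frame `γ_r B` lies in `Γ_H(g_q K g_q⁻¹)`; `hJ2`: an element of `Γ_H(g_q K g_q⁻¹)` stabilising the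
plane `(γ_r B)(L² ⊕ 0)` is such a conjugate — [Deligne1971TravauxShimura] Prop. 1.15 «`ζ = 1`» at `B`-adapted depth; both are the
group bookkeeping of `UnitaryGroupTraceLevelJunction`, taken here as hypotheses quantified over the bookkeepers).

RESULT `UnitaryCanonicalModel.exists_specialCurves_indexed` — **the ∃-package of the road-(ii) head** (the `hL33` binder of ★
`RecordSystem.exists_recordSystemGS_of_recordSystem`, edition v1, with the pieces indexed by the surface double cosets): representatives
`g⋆_r` of the curve's double cosets `r ∈ U(J⋆)(L⁺) \ U(J⋆)(𝔸_f) / K⋆` (★ `ShimuraDissection.exists_representatives`), the surface class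
`q′(r) = ⟦φGS(g⋆_r) K⟧` of each, bookkeepers `γ_r ∈ U(H)(L⁺)` with `g_{q′(r)}⁻¹ γ_{r,f} φGS(g⋆_r) ∈ K` (★ `exists_rational_smul_rep_mem`),
and for every `r` a reduced closed special curve `κ_r : Z_r ↪ X_{q′(r)}` with a disc datum `B⋆_r : UnitaryBallUniformisationDatum 1 (Z_r)`
such that `B⋆_r.Hℂ = J⋆^τ`, `τ₁(B⋆_r.Γ) = Γ_{J⋆}(g⋆_r K⋆ g⋆_r⁻¹)^τ` (LEVEL JUNCTION) and `κ_r(ℂ)(unif⋆_r v) = unif_{q′(r)}((γ_r B)^τ(v ⊕ 0))`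
— exactly the data `(gs, hgs, q′, γ, hγ, Z, hred, κ, hcl, Bs, hBs, hΓs, hf)` consumed by ★ `exists_cofan_pieces_of_specialCurves`, ★
`exists_unif_differentiableOn_of_cofan_pieces`, ★ `pairwise_disjoint_and_iUnion_range_eq_of_specialCurves`, ★
`mem_range_emb_of_pt_mem_closure_of_specialCurves`.  Per `r` this is ★ `exists_specialCurveDatum_of_subfieldCode'` (leaf L3.3 (a)+(b))
at the frame `γ_r B`, a Sylvester frame of the piece (★ `nonempty_sylvesterFrame`), the congruence property of the curve level (★
`isCongruenceSubgroup_arithmeticLevel_of_isOpen`), the junction clauses `hJ1`/`hJ2`, and the no-self-intersection clause (★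
`mem_lineStab_of_smul_mem_specialBall_of_embPoints_injective`, leaf L3.3 (c), from injective `embPoints` and `hJ1` through ★
`conj_blockDiag_mem_of_code`).

## References
* [Deligne1971TravauxShimura] P. Deligne, *Travaux de Shimura*, Sém. Bourbaki 389 (1971), Prop. 1.15 and its proof pp. 132–133.
* [Deligne1979ShimuraVarieties] P. Deligne, *Variétés de Shimura* (1979), 2.1.2–2.1.4 (the pieces `Γ_g∖X⁺`).
* [Milne2005ShimuraVarieties] J. S. Milne, *Introduction to Shimura varieties* (2005/2017), Lemma 5.13 p. 57, Thm. 5.16 p. 59, Thm. 13.6 p. 118.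
* [BergeronMillsonMoeglin2016Balls] N. Bergeron, J. Millson, C. Moeglin, Acta Math. 216 (2016), Part 2 §§1.1–1.4, 3.1–3.3.
* [KudlaMillson1990] S. Kudla, J. Millson, Publ. Math. IHÉS 71 (1990), Lemma 1.1 p. 128.
* [Liu2021] Y. Liu, Camb. J. Math. 9 (2021), proof of Thm. 4.15 (FJcycle.tex l. 2193–2208).
-/

set_option autoImplicit false

noncomputable section

open scoped ComplexOrder
open Matrix Complex NumberField Set Function MulAction CategoryTheory AlgebraicGeometry
open Literature.Geometry.ComplexHyperbolic Literature.Geometry.ComplexHyperbolic.BallModel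
open Literature.NumberTheory.Automorphic Literature.NumberTheory.Automorphic.UnitaryGroup
open Literature.NumberTheory.Automorphic.ShimuraDissection
open Literature.AlgebraicGeometry.Motives (SchemeOver ComplexPoints AlgPoints)

namespace Literature.AlgebraicGeometry.ShimuraVarieties.UnitaryCanonicalModel

variable {L : Type} [Field L] [NumberField L] [IsCMField L] {Jstar : Matrix (Fin 2) (Fin 2) L} (τ : L →+* ℂ)
  {H : Matrix (Fin 3) (Fin 3) L} {T : GL (Fin 3) ℂ} (hT : formCongr (starRingEnd ℂ) T (H.map τ) = BallModel.J)

/-! ### §1. Plumbing: conjugates of compact open levels -/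

omit [NumberField L] [IsCMField L] in
/-- A conjugate `gKg⁻¹` of an open level is open (conjugation is a homeomorphism). [folklore] -/
private theorem isOpen_map_conj'' {A : Type*} [Group A] [TopologicalSpace A] [IsTopologicalGroup A]
    {K : Subgroup A} (hK : IsOpen (K : Set A)) (g : A) :
    IsOpen ((K.map (MulAut.conj g).toMonoidHom : Subgroup A) : Set A) := by
  rw [Subgroup.coe_map]
  have : (⇑(MulAut.conj g).toMonoidHom : A → A) = (Homeomorph.mulLeft g).trans (Homeomorph.mulRight g⁻¹) := by
    ext x; rfl
  rw [this]
  exact (Homeomorph.isOpenMap _) _ hK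

omit [NumberField L] [IsCMField L] in
/-- A conjugate `gKg⁻¹` of a compact level is compact (continuous image). [folklore] -/
private theorem isCompact_map_conj'' {A : Type*} [Group A] [TopologicalSpace A] [IsTopologicalGroup A]
    {K : Subgroup A} (hK : IsCompact (K : Set A)) (g : A) :
    IsCompact ((K.map (MulAut.conj g).toMonoidHom : Subgroup A) : Set A) := by
  rw [Subgroup.coe_map]
  have : (⇑(MulAut.conj g).toMonoidHom : A → A) = (Homeomorph.mulLeft g).trans (Homeomorph.mulRight g⁻¹) := by
    ext x; rfl
  rw [this]
  exact hK.image (Homeomorph.continuous _)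

/-- `ᵗ(c(γB))·H′·(γB) = ᵗ(cB)·H′·B` for `γ ∈ U(H)(L⁺)` and `H′ = a • H` (in-file twin of ★ `formCongr_mul_of_mem_rational`, in the
`toRingEquiv.toRingHom` spelling of ★ `exists_specialCurveDatum_of_subfieldCode'`). [cite: BergeronMillsonMoeglin2016Balls, Part 2 §1.2 and §3.1] -/
private theorem formCongr_mul_of_mem_rational'' (γ : ↥(rational (↥(maximalRealSubfield L)) L (IsCMField.complexConj L) 3 H))
    (B : GL (Fin 3) L) (a : L) :
    formCongr (IsCMField.complexConj L).toRingEquiv.toRingHom ((γ : GL (Fin 3) L) * B) (a • H) =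
      formCongr (IsCMField.complexConj L).toRingEquiv.toRingHom B (a • H) := by
  have hγ := mem_unitaryGroupOfForm_iff.1 γ.2
  have hγa : (((γ : GL (Fin 3) L) : Matrix (Fin 3) (Fin 3) L).map (IsCMField.complexConj L).toRingEquiv.toRingHom)ᵀ * (a • H) *
        ((γ : GL (Fin 3) L) : Matrix (Fin 3) (Fin 3) L) = a • H := by
    rw [Matrix.mul_smul, Matrix.smul_mul]
    exact congrArg (a • ·) hγ
  calc formCongr (IsCMField.complexConj L).toRingEquiv.toRingHom ((γ : GL (Fin 3) L) * B) (a • H)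
      = ((B : Matrix (Fin 3) (Fin 3) L).map (IsCMField.complexConj L).toRingEquiv.toRingHom)ᵀ *
          ((((γ : GL (Fin 3) L) : Matrix (Fin 3) (Fin 3) L).map (IsCMField.complexConj L).toRingEquiv.toRingHom)ᵀ * (a • H) *
            ((γ : GL (Fin 3) L) : Matrix (Fin 3) (Fin 3) L)) * (B : Matrix (Fin 3) (Fin 3) L) := by
        simp only [formCongr, Units.val_mul, Matrix.map_mul, Matrix.transpose_mul, Matrix.mul_assoc]
    _ = formCongr (IsCMField.complexConj L).toRingEquiv.toRingHom B (a • H) := by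
        rw [hγa]

/-! ### §2. The indexed special curves -/

include hT in
/-- **The special curves of the surface pieces, indexed by the curve's double cosets** (road (ii), the ∃-package of the head).
With the setting of the module docstring: there are representatives `g⋆_r` of `U(J⋆)(L⁺) \ U(J⋆)(𝔸_f) / K⋆` (`⟦g⋆_r K⋆⟧ = r`), surface
classes `q′(r)`, bookkeepers `γ_r ∈ U(H)(L⁺)` (`g_{q′(r)}⁻¹ γ_{r,f} φGS(g⋆_r) ∈ K`), and for every `r` a REDUCED CLOSED special curve
`κ_r : Z_r ↪ X_{q′(r)}` with a disc datum `B⋆_r` of Gram matrix `J⋆^τ`, group `τ₁(B⋆_r.Γ) = Γ_{J⋆}(g⋆_r K⋆ g⋆_r⁻¹)^τ` and uniformisation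
intertwined with the piece along the frame `γ_r B`: `κ_r(ℂ)(unif⋆_r v) = unif_{q′(r)}((γ_r B)^τ(v ⊕ 0))` on the negative cone of `J⋆^τ`.
[cite: Deligne1979ShimuraVarieties, 2.1.2–2.1.4] [cite: Deligne1971TravauxShimura, Prop. 1.15 and proof pp. 132–133]
[cite: Milne2005ShimuraVarieties, Lemma 5.13 p. 57, Thm. 5.16 p. 59] [cite: BergeronMillsonMoeglin2016Balls, Part 2 §§3.1–3.3]
[cite: KudlaMillson1990, Lemma 1.1 p. 128] [cite: Liu2021, proof of Thm. 4.15 l. 2207] -/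
theorem exists_specialCurves_indexed (Jperp : Matrix (Fin 1) (Fin 1) L) (B : GL (Fin 3) L)
    (hB : formCongr ((IsCMField.complexConj L : L ≃ₐ[↥(maximalRealSubfield L)] L) : L →+* L) B ((1 : L) • H) = finSum 2 1 Jstar Jperp)
    (hτ1 : 0 < (τ 1).re) (hτ1' : (τ 1).im = 0) (hpos : 0 < (τ (Jperp 0 0)).re)
    (Kstar : Subgroup ↥(finAdelic (↥(maximalRealSubfield L)) L (IsCMField.complexConj L) 2 Jstar))
    (K : Subgroup ↥(finAdelic (↥(maximalRealSubfield L)) L (IsCMField.complexConj L) 3 H))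
    (hK : Kstar.map (φGS L Jstar Jperp H B one_ne_zero hB) ≤ K)
    (hKo : IsOpen (Kstar : Set ↥(finAdelic (↥(maximalRealSubfield L)) L (IsCMField.complexConj L) 2 Jstar)))
    (hKc : IsCompact (Kstar : Set ↥(finAdelic (↥(maximalRealSubfield L)) L (IsCMField.complexConj L) 2 Jstar)))
    (hinj : Function.Injective (ShimuraSetGS.embPoints L H τ T hT Jstar Jperp B one_ne_zero hB hτ1 hτ1' Kstar K hK))
    -- LEVEL-JUNCTION bookkeeping of the trace pair (`UnitaryGroupTraceLevelJunction`), quantified over the bookkeepers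
    (hJ1 : ∀ (g₃ : ↥(finAdelic (↥(maximalRealSubfield L)) L (IsCMField.complexConj L) 3 H))
        (g₂ : ↥(finAdelic (↥(maximalRealSubfield L)) L (IsCMField.complexConj L) 2 Jstar))
        (γr : ↥(rational (↥(maximalRealSubfield L)) L (IsCMField.complexConj L) 3 H)),
        g₃⁻¹ * (rationalToFinAdelic (↥(maximalRealSubfield L)) L (IsCMField.complexConj L) 3 H γr * φGS L Jstar Jperp H B one_ne_zero hB g₂) ∈ K →
        ∀ γ₁ ∈ arithmeticLevel (↥(maximalRealSubfield L)) L (IsCMField.complexConj L) 2 Jstar (Kstar.map (MulAut.conj g₂).toMonoidHom),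
          ((γr : GL (Fin 3) L) * B) * reindexGL finSumFinEquiv (blockDiagGL (γ₁, (1 : GL (Fin 1) L))) * ((γr : GL (Fin 3) L) * B)⁻¹ ∈
            arithmeticLevel (↥(maximalRealSubfield L)) L (IsCMField.complexConj L) 3 H (K.map (MulAut.conj g₃).toMonoidHom))
    (hJ2 : ∀ (g₃ : ↥(finAdelic (↥(maximalRealSubfield L)) L (IsCMField.complexConj L) 3 H))
        (g₂ : ↥(finAdelic (↥(maximalRealSubfield L)) L (IsCMField.complexConj L) 2 Jstar))
        (γr : ↥(rational (↥(maximalRealSubfield L)) L (IsCMField.complexConj L) 3 H)),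
        g₃⁻¹ * (rationalToFinAdelic (↥(maximalRealSubfield L)) L (IsCMField.complexConj L) 3 H γr * φGS L Jstar Jperp H B one_ne_zero hB g₂) ∈ K →
        ∀ δ ∈ arithmeticLevel (↥(maximalRealSubfield L)) L (IsCMField.complexConj L) 3 H (K.map (MulAut.conj g₃).toMonoidHom),
          (∀ x : Fin 2 → L, ∃ y : Fin 2 → L,
            ((δ : GL (Fin 3) L) : Matrix (Fin 3) (Fin 3) L) *ᵥ
                ((((γr : GL (Fin 3) L) * B : GL (Fin 3) L) : Matrix (Fin 3) (Fin 3) L) *ᵥ Fin.append x (0 : Fin 1 → L)) =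
              (((γr : GL (Fin 3) L) * B : GL (Fin 3) L) : Matrix (Fin 3) (Fin 3) L) *ᵥ Fin.append y (0 : Fin 1 → L)) →
          ∃ γ₁ ∈ arithmeticLevel (↥(maximalRealSubfield L)) L (IsCMField.complexConj L) 2 Jstar (Kstar.map (MulAut.conj g₂).toMonoidHom),
            δ = ((γr : GL (Fin 3) L) * B) * reindexGL finSumFinEquiv (blockDiagGL (γ₁, (1 : GL (Fin 1) L))) * ((γr : GL (Fin 3) L) * B)⁻¹)
    -- the CODED surface pieces at level `K`, indexed by the surface double cosets with a section
    {X : orbitRel.Quotient ↥(rational (↥(maximalRealSubfield L)) L (IsCMField.complexConj L) 3 H)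
        (CosetSpace (rationalToFinAdelic (↥(maximalRealSubfield L)) L (IsCMField.complexConj L) 3 H) K) → SchemeOver ℂ}
    (Bq : ∀ q, UnitaryBallUniformisationDatum 2 (X q))
    (gq : orbitRel.Quotient ↥(rational (↥(maximalRealSubfield L)) L (IsCMField.complexConj L) 3 H)
        (CosetSpace (rationalToFinAdelic (↥(maximalRealSubfield L)) L (IsCMField.complexConj L) 3 H) K) →
      ↥(finAdelic (↥(maximalRealSubfield L)) L (IsCMField.complexConj L) 3 H))
    (hgq : ∀ q, Quotient.mk'' (CosetSpace.pt (rationalToFinAdelic (↥(maximalRealSubfield L)) L (IsCMField.complexConj L) 3 H) K (gq q)) = q)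
    (eq : ∀ q, L ≃+* ↥(Bq q).E) (he : ∀ q (x : L), ((eq q x : ↥(Bq q).E) : ℂ) = τ x)
    (hH : ∀ q, (Bq q).H = H.map (eq q).toRingHom)
    (hΓ : ∀ q, (Bq q).Γ = (arithmeticLevel (↥(maximalRealSubfield L)) L (IsCMField.complexConj L) 3 H
        (K.map (MulAut.conj (gq q)).toMonoidHom)).map (Matrix.GeneralLinearGroup.map (eq q).toRingHom)) :
    ∃ (gs : orbitRel.Quotient ↥(rational (↥(maximalRealSubfield L)) L (IsCMField.complexConj L) 2 Jstar)
          (CosetSpace (rationalToFinAdelic (↥(maximalRealSubfield L)) L (IsCMField.complexConj L) 2 Jstar) Kstar) →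
        ↥(finAdelic (↥(maximalRealSubfield L)) L (IsCMField.complexConj L) 2 Jstar))
      (_ : ∀ r, Quotient.mk'' (CosetSpace.pt (rationalToFinAdelic (↥(maximalRealSubfield L)) L (IsCMField.complexConj L) 2 Jstar)
        Kstar (gs r)) = r)
      (q' : orbitRel.Quotient ↥(rational (↥(maximalRealSubfield L)) L (IsCMField.complexConj L) 2 Jstar)
          (CosetSpace (rationalToFinAdelic (↥(maximalRealSubfield L)) L (IsCMField.complexConj L) 2 Jstar) Kstar) →
        orbitRel.Quotient ↥(rational (↥(maximalRealSubfield L)) L (IsCMField.complexConj L) 3 H)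
          (CosetSpace (rationalToFinAdelic (↥(maximalRealSubfield L)) L (IsCMField.complexConj L) 3 H) K))
      (γ : orbitRel.Quotient ↥(rational (↥(maximalRealSubfield L)) L (IsCMField.complexConj L) 2 Jstar)
          (CosetSpace (rationalToFinAdelic (↥(maximalRealSubfield L)) L (IsCMField.complexConj L) 2 Jstar) Kstar) →
        ↥(rational (↥(maximalRealSubfield L)) L (IsCMField.complexConj L) 3 H))
      (_ : ∀ r, (gq (q' r))⁻¹ * (rationalToFinAdelic (↥(maximalRealSubfield L)) L (IsCMField.complexConj L) 3 H (γ r) *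
        φGS L Jstar Jperp H B one_ne_zero hB (gs r)) ∈ K)
      (Z : orbitRel.Quotient ↥(rational (↥(maximalRealSubfield L)) L (IsCMField.complexConj L) 2 Jstar)
          (CosetSpace (rationalToFinAdelic (↥(maximalRealSubfield L)) L (IsCMField.complexConj L) 2 Jstar) Kstar) → SchemeOver ℂ)
      (_ : ∀ r, IsReduced (Z r).left) (κ : ∀ r, Z r ⟶ X (q' r)) (_ : ∀ r, IsClosedImmersion (κ r).left)
      (Bs : ∀ r, UnitaryBallUniformisationDatum 1 (Z r)),
      (∀ r, (Bs r).Hℂ = Jstar.map τ) ∧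
      (∀ r, (Bs r).Γ.map (Matrix.GeneralLinearGroup.map ((Bs r).τ₁ : ↥(Bs r).E →+* ℂ)) =
        (arithmeticLevel (↥(maximalRealSubfield L)) L (IsCMField.complexConj L) 2 Jstar
          (Kstar.map (MulAut.conj (gs r)).toMonoidHom)).map (Matrix.GeneralLinearGroup.map τ)) ∧
      (∀ r, ∀ v ∈ negCone (Jstar.map τ),
        AlgPoints.map (κ r) ((Bs r).unif v) = (Bq (q' r)).unif (frameEmbNeg τ ((γ r : GL (Fin 3) L) * B) v)) := by
  classical
  -- (1) representatives of the curve's double cosets, their surface classes and bookkeepers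
  obtain ⟨gs, hgs⟩ := exists_representatives (rationalToFinAdelic (↥(maximalRealSubfield L)) L (IsCMField.complexConj L) 2 Jstar) Kstar
  let q' : orbitRel.Quotient ↥(rational (↥(maximalRealSubfield L)) L (IsCMField.complexConj L) 2 Jstar)
        (CosetSpace (rationalToFinAdelic (↥(maximalRealSubfield L)) L (IsCMField.complexConj L) 2 Jstar) Kstar) →
      orbitRel.Quotient ↥(rational (↥(maximalRealSubfield L)) L (IsCMField.complexConj L) 3 H)
        (CosetSpace (rationalToFinAdelic (↥(maximalRealSubfield L)) L (IsCMField.complexConj L) 3 H) K) :=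
    fun r => Quotient.mk'' (CosetSpace.pt (rationalToFinAdelic (↥(maximalRealSubfield L)) L (IsCMField.complexConj L) 3 H) K
      (φGS L Jstar Jperp H B one_ne_zero hB (gs r)))
  have hγex : ∀ r, ∃ γr : ↥(rational (↥(maximalRealSubfield L)) L (IsCMField.complexConj L) 3 H),
      (gq (q' r))⁻¹ * (rationalToFinAdelic (↥(maximalRealSubfield L)) L (IsCMField.complexConj L) 3 H γr *
        φGS L Jstar Jperp H B one_ne_zero hB (gs r)) ∈ K := fun r => by
    obtain ⟨γ₀, h⟩ := exists_rational_smul_rep_mem (F := ↥(maximalRealSubfield L)) (c := IsCMField.complexConj L) hgq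
      (φGS L Jstar Jperp H B one_ne_zero hB (gs r))
    refine ⟨γ₀, ?_⟩
    have h' := K.inv_mem h
    rwa [_root_.mul_inv_rev, inv_inv] at h'
  choose γ hγ using hγex
  -- (2) per class `r`: the special curve datum of the coded piece `q′(r)` at the frame `γ_r B`
  have hBL : ∀ r, formCongr (IsCMField.complexConj L).toRingEquiv.toRingHom ((γ r : GL (Fin 3) L) * B) ((1 : L) • H) =
      finSum 2 1 Jstar Jperp := fun r => by
    rw [formCongr_mul_of_mem_rational'' (γ r) B 1]
    exact hB
  have main : ∀ r, ∃ (Zr : SchemeOver ℂ) (κr : Zr ⟶ X (q' r)) (_ : IsClosedImmersion κr.left) (_ : IsReduced Zr.left)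
      (B₁ : UnitaryBallUniformisationDatum 1 Zr),
      B₁.Hℂ = Jstar.map τ ∧
      B₁.Γ.map (Matrix.GeneralLinearGroup.map (B₁.τ₁ : ↥B₁.E →+* ℂ)) =
        (arithmeticLevel (↥(maximalRealSubfield L)) L (IsCMField.complexConj L) 2 Jstar
          (Kstar.map (MulAut.conj (gs r)).toMonoidHom)).map (Matrix.GeneralLinearGroup.map τ) ∧
      ∀ v ∈ negCone (Jstar.map τ),
        AlgPoints.map κr (B₁.unif v) = (Bq (q' r)).unif (frameEmbNeg τ ((γ r : GL (Fin 3) L) * B) v) := fun r => by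
    obtain ⟨𝔣⟩ := (Bq (q' r)).nonempty_sylvesterFrame
    -- the curve level `Γ₁ = Γ_{J⋆}(g⋆_r K⋆ g⋆_r⁻¹)` is a congruence subgroup
    have hΓ₁L : IsCongruenceSubgroup (IsCMField.complexConj L).toRingEquiv.toRingHom Jstar
        (arithmeticLevel (↥(maximalRealSubfield L)) L (IsCMField.complexConj L) 2 Jstar (Kstar.map (MulAut.conj (gs r)).toMonoidHom)) :=
      isCongruenceSubgroup_arithmeticLevel_of_isOpen (isCompact_map_conj'' hKc (gs r)) (isOpen_map_conj'' hKo (gs r))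
    -- the two junction clauses at this bookkeeper
    have hΓ₁Γ := hJ1 (gq (q' r)) (gs r) (γ r) (hγ r)
    have hΓΓ₁ := hJ2 (gq (q' r)) (gs r) (γ r) (hγ r)
    -- no self-intersection at the framed line (injective `embPoints`)
    have hinjD := (Bq (q' r)).mem_lineStab_of_smul_mem_specialBall_of_embPoints_injective τ (eq (q' r)) (he (q' r)) (hH (q' r))
      hT Jperp B one_ne_zero hB hτ1 hτ1' hpos hK (gq (q' r)) (hΓ (q' r)) (gs r) (γ r) (hγ r) 𝔣
      ((Bq (q' r)).conj_blockDiag_mem_of_code (eq (q' r)) (hΓ (q' r)) ((γ r : GL (Fin 3) L) * B) hΓ₁Γ) hinj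
    obtain ⟨Zr, κr, hκ, hred, B₁, hH₁, hΓ₁, hcomp, -⟩ :=
      (Bq (q' r)).exists_specialCurveDatum_of_subfieldCode' τ (eq (q' r)) (he (q' r)) (hΓ (q' r)) (hH (q' r))
        ((γ r : GL (Fin 3) L) * B) one_ne_zero Jstar Jperp (hBL r) 𝔣 hτ1 hτ1' hpos _ hΓ₁L hΓ₁Γ hΓΓ₁ hinjD
    refine ⟨Zr, κr, hκ, hred, B₁, ?_, hΓ₁, fun v hv => ?_⟩
    · rw [hH₁, map_one, inv_one, one_smul]
    · rw [hcomp v hv]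
      rfl
  choose Z κ hκ hred Bs hHs hΓs hfs using main
  exact ⟨gs, hgs, q', γ, hγ, Z, hred, κ, hκ, Bs, hHs, hΓs, hfs⟩

end Literature.AlgebraicGeometry.ShimuraVarieties.UnitaryCanonicalModel

end
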